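import Summits.Ventures.PercRepro.SevenThreeSmallPlanesFrame

/-!
# PercRepro — the `(7,3)` cell, (R6) part (f4): the triangle (night-3, gen 4)

For a plane `G` on `6` points with exactly three three-point lines `ℓ₁, ℓ₂, ℓ₃`, pairwise meeting in one point and
covering `G` (the chain's `NightThree.Triangle`): `R₃(G)` is the set of subsets with `≥ 3` points other than the
lines (`R3_eq_of_triangle`), `λ(B) = [ℓ₁ ⊆ B] + [ℓ₂ ⊆ B] + [ℓ₃ ⊆ B]` (`lam3_eq_of_triangle`), and by
inclusion–exclusion over the three indicators the cell sum is
`Σ_b C(6,b)·f(b,0) + 3·C(3,b−3)·Δf + 3·C(1,b−5)·Δ²f + C(0,b−6)·Δ³f` minus the three lines at `b = 3`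
(`sum_R3_triangle`): the profile `17×(3,0) + 9×(4,1) + 6×(4,0) + 3×(5,1) + 3×(5,2) + (6,3)`; the cells
`cell_triangle_t*` give the per-plane inequality (`perPlane_triangle`).  Axioms: standard.
-/

namespace PercRepro

namespace SevenThree

open Finset ThmH SixThree PerFlat

variable {α : Type*} [DecidableEq α] {M : Matroid α} [M.Finite]

/-- The rank-`2` triples of the triangle inside `B` are its lines contained in `B`. -/
theorem lam3_eq_of_triangle {G ℓ₁ ℓ₂ ℓ₃ : Finset α} (h1 : ℓ₁.card = 3) (h2 : ℓ₂.card = 3) (h3 : ℓ₃.card = 3)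
    (r1 : M.eRk (ℓ₁ : Set α) = 2) (r2 : M.eRk (ℓ₂ : Set α) = 2) (r3 : M.eRk (ℓ₃ : Set α) = 2)
    (n12 : ℓ₁ ≠ ℓ₂) (n13 : ℓ₁ ≠ ℓ₃) (n23 : ℓ₂ ≠ ℓ₃)
    (hfree : ∀ T ∈ G.powersetCard 3, T ≠ ℓ₁ → T ≠ ℓ₂ → T ≠ ℓ₃ → M.Indep (T : Set α)) {B : Finset α} (hB : B ⊆ G) :
    lam3 M B = (if ℓ₁ ⊆ B then 1 else 0) + (if ℓ₂ ⊆ B then 1 else 0) + (if ℓ₃ ⊆ B then 1 else 0) := by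
  unfold lam3
  have hset : (B.powersetCard 3).filter (fun T : Finset α => M.eRk (T : Set α) = 2) =
      (if ℓ₁ ⊆ B then {ℓ₁} else ∅) ∪ (if ℓ₂ ⊆ B then {ℓ₂} else ∅) ∪ (if ℓ₃ ⊆ B then {ℓ₃} else ∅) := by
    ext T
    rw [Finset.mem_filter, Finset.mem_powersetCard, Finset.mem_union, Finset.mem_union]
    constructor
    · rintro ⟨⟨hTB, hT3⟩, hr⟩
      by_cases e1 : T = ℓ₁
      · subst e1; left; left; rw [if_pos hTB]; exact Finset.mem_singleton_self T
      by_cases e2 : T = ℓ₂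
      · subst e2; left; right; rw [if_pos hTB]; exact Finset.mem_singleton_self T
      by_cases e3 : T = ℓ₃
      · subst e3; right; rw [if_pos hTB]; exact Finset.mem_singleton_self T
      exfalso
      have hind := hfree T (Finset.mem_powersetCard.2 ⟨hTB.trans hB, hT3⟩) e1 e2 e3
      rw [hind.eRk_eq_encard, Set.encard_coe_eq_coe_finsetCard, hT3] at hr
      exact absurd hr (by decide)
    · rintro ((hT | hT) | hT)
      · by_cases h : ℓ₁ ⊆ B
        · rw [if_pos h, Finset.mem_singleton] at hT; subst hT; exact ⟨⟨h, h1⟩, r1⟩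
        · rw [if_neg h] at hT; exact absurd hT (Finset.notMem_empty T)
      · by_cases h : ℓ₂ ⊆ B
        · rw [if_pos h, Finset.mem_singleton] at hT; subst hT; exact ⟨⟨h, h2⟩, r2⟩
        · rw [if_neg h] at hT; exact absurd hT (Finset.notMem_empty T)
      · by_cases h : ℓ₃ ⊆ B
        · rw [if_pos h, Finset.mem_singleton] at hT; subst hT; exact ⟨⟨h, h3⟩, r3⟩
        · rw [if_neg h] at hT; exact absurd hT (Finset.notMem_empty T)
  rw [hset]
  have hc : ∀ (ℓ : Finset α) (p : Prop) [Decidable p], (if p then ({ℓ} : Finset (Finset α)) else ∅).card =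
      if p then 1 else 0 := by
    intro ℓ p _
    split_ifs <;> simp
  have hd12 : Disjoint (if ℓ₁ ⊆ B then ({ℓ₁} : Finset (Finset α)) else ∅) (if ℓ₂ ⊆ B then {ℓ₂} else ∅) := by
    split_ifs <;> simp [n12]
  have hd3 : Disjoint ((if ℓ₁ ⊆ B then ({ℓ₁} : Finset (Finset α)) else ∅) ∪ (if ℓ₂ ⊆ B then {ℓ₂} else ∅))
      (if ℓ₃ ⊆ B then {ℓ₃} else ∅) := by
    rw [Finset.disjoint_union_left]
    constructor <;> split_ifs <;> simp [n13, n23]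
  rw [Finset.card_union_of_disjoint hd3, Finset.card_union_of_disjoint hd12, hc, hc, hc]

omit [M.Finite] in
/-- A subset with `≥ 4` points of a three-line plane contains an independent triple. -/
theorem exists_indep_triple_of_four_triangle {G ℓ₁ ℓ₂ ℓ₃ B : Finset α}
    (hfree : ∀ T ∈ G.powersetCard 3, T ≠ ℓ₁ → T ≠ ℓ₂ → T ≠ ℓ₃ → M.Indep (T : Set α)) (hB : B ⊆ G)
    (hB4 : 4 ≤ B.card) : ∃ T ⊆ B, T.card = 3 ∧ M.Indep (T : Set α) := by
  obtain ⟨B₄, hB₄B, hB₄4⟩ := Finset.exists_subset_card_eq hB4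
  have h4 : (B₄.powersetCard 3).card = 4 := by rw [Finset.card_powersetCard, hB₄4]; decide
  have hpos : 0 < ((B₄.powersetCard 3) \ {ℓ₁, ℓ₂, ℓ₃}).card := by
    have h1 := Finset.le_card_sdiff ({ℓ₁, ℓ₂, ℓ₃} : Finset (Finset α)) (B₄.powersetCard 3)
    have h2 : ({ℓ₁, ℓ₂, ℓ₃} : Finset (Finset α)).card ≤ 3 := Finset.card_le_three
    omega
  obtain ⟨T, hT⟩ := Finset.card_pos.1 hpos
  rw [Finset.mem_sdiff, Finset.mem_powersetCard, Finset.mem_insert, Finset.mem_insert, Finset.mem_singleton] at hT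
  push Not at hT
  refine ⟨T, hT.1.1.trans hB₄B, hT.1.2, ?_⟩
  exact hfree T (Finset.mem_powersetCard.2 ⟨(hT.1.1.trans hB₄B).trans hB, hT.1.2⟩) hT.2.1 hT.2.2.1 hT.2.2.2

/-- `R₃(G)` of the triangle: the subsets with `≥ 3` points other than the three lines. -/
theorem R3_eq_of_triangle {G ℓ₁ ℓ₂ ℓ₃ : Finset α} (hG : G ∈ planes M)
    (r1 : M.eRk (ℓ₁ : Set α) = 2) (r2 : M.eRk (ℓ₂ : Set α) = 2) (r3 : M.eRk (ℓ₃ : Set α) = 2)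
    (hfree : ∀ T ∈ G.powersetCard 3, T ≠ ℓ₁ → T ≠ ℓ₂ → T ≠ ℓ₃ → M.Indep (T : Set α)) (hg : G.card = 6) :
    R3 M G = (G.powersetCard 3) \ {ℓ₁, ℓ₂, ℓ₃} ∪ G.powersetCard 4 ∪ G.powersetCard 5 ∪ G.powersetCard 6 := by
  have hG3 := (mem_planes.1 hG).2.2
  ext B
  rw [mem_R3_iff, Finset.mem_union, Finset.mem_union, Finset.mem_union, Finset.mem_sdiff, Finset.mem_insert,
    Finset.mem_insert, Finset.mem_singleton, Finset.mem_powersetCard, Finset.mem_powersetCard,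
    Finset.mem_powersetCard, Finset.mem_powersetCard]
  constructor
  · rintro ⟨hBG, hr⟩
    have h3 := three_le_card_of_eRk_eq_three hr
    have h6 : B.card ≤ 6 := (Finset.card_le_card hBG).trans hg.le
    rcases (show B.card = 3 ∨ B.card = 4 ∨ B.card = 5 ∨ B.card = 6 by omega) with hc | hc | hc | hc
    · left; left; left
      refine ⟨⟨hBG, hc⟩, ?_⟩
      rintro (rfl | rfl | rfl)
      · rw [r1] at hr; exact absurd hr (by decide)
      · rw [r2] at hr; exact absurd hr (by decide)
      · rw [r3] at hr; exact absurd hr (by decide)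
    · exact Or.inl (Or.inl (Or.inr ⟨hBG, hc⟩))
    · exact Or.inl (Or.inr ⟨hBG, hc⟩)
    · exact Or.inr ⟨hBG, hc⟩
  · intro hB
    have hBG : B ⊆ G := by
      rcases hB with ((h | h) | h) | h
      · exact h.1.1
      · exact h.1
      · exact h.1
      · exact h.1
    refine ⟨hBG, le_antisymm ?_ ?_⟩
    · rw [← hG3]; exact M.eRk_mono (Finset.coe_subset.2 hBG)
    · obtain ⟨T, hTB, hT3, hind⟩ : ∃ T ⊆ B, T.card = 3 ∧ M.Indep (T : Set α) := by
        rcases hB with ((h | h) | h) | h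
        · push Not at h
          exact ⟨B, Finset.Subset.refl B, h.1.2, hfree B (Finset.mem_powersetCard.2 h.1) h.2.1 h.2.2.1 h.2.2.2⟩
        · exact exists_indep_triple_of_four_triangle hfree hBG (by omega)
        · exact exists_indep_triple_of_four_triangle hfree hBG (by omega)
        · exact exists_indep_triple_of_four_triangle hfree hBG (by omega)
      calc (3 : ℕ∞) = M.eRk (T : Set α) := by
            rw [hind.eRk_eq_encard, Set.encard_coe_eq_coe_finsetCard, hT3]; rfl
        _ ≤ M.eRk (B : Set α) := M.eRk_mono (Finset.coe_subset.2 hTB)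

/-- The sum over the `b`-subsets of the triangle of a function of `(b, λ)`, by inclusion–exclusion over the three
indicators. -/
theorem sum_powersetCard_triangle {G ℓ₁ ℓ₂ ℓ₃ : Finset α} (s1 : ℓ₁ ⊆ G) (s2 : ℓ₂ ⊆ G) (s3 : ℓ₃ ⊆ G)
    (h1 : ℓ₁.card = 3) (h2 : ℓ₂.card = 3) (h3 : ℓ₃.card = 3)
    (r1 : M.eRk (ℓ₁ : Set α) = 2) (r2 : M.eRk (ℓ₂ : Set α) = 2) (r3 : M.eRk (ℓ₃ : Set α) = 2)
    (n12 : ℓ₁ ≠ ℓ₂) (n13 : ℓ₁ ≠ ℓ₃) (n23 : ℓ₂ ≠ ℓ₃)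
    (u12 : (ℓ₁ ∪ ℓ₂).card = 5) (u13 : (ℓ₁ ∪ ℓ₃).card = 5) (u23 : (ℓ₂ ∪ ℓ₃).card = 5)
    (u123 : ℓ₁ ∪ ℓ₂ ∪ ℓ₃ = G) (hg : G.card = 6)
    (hfree : ∀ T ∈ G.powersetCard 3, T ≠ ℓ₁ → T ≠ ℓ₂ → T ≠ ℓ₃ → M.Indep (T : Set α)) (f : ℕ → ℕ → ℚ) (b : ℕ) :
    ∑ B ∈ G.powersetCard b, f B.card (lam3 M B) =
      (Nat.choose 6 b : ℚ) * f b 0 +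
        3 * ((if 3 ≤ b then Nat.choose 3 (b - 3) else 0 : ℕ) : ℚ) * (f b 1 - f b 0) +
        3 * ((if 5 ≤ b then Nat.choose 1 (b - 5) else 0 : ℕ) : ℚ) * (f b 2 - 2 * f b 1 + f b 0) +
        ((if 6 ≤ b then Nat.choose 0 (b - 6) else 0 : ℕ) : ℚ) * (f b 3 - 3 * f b 2 + 3 * f b 1 - f b 0) := by
  have hpt : ∀ B ∈ G.powersetCard b, f B.card (lam3 M B) =
      f b 0 + ((if ℓ₁ ⊆ B then (1 : ℚ) else 0) + (if ℓ₂ ⊆ B then (1 : ℚ) else 0) +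
          (if ℓ₃ ⊆ B then (1 : ℚ) else 0)) * (f b 1 - f b 0) +
        ((if ℓ₁ ∪ ℓ₂ ⊆ B then (1 : ℚ) else 0) + (if ℓ₁ ∪ ℓ₃ ⊆ B then (1 : ℚ) else 0) +
          (if ℓ₂ ∪ ℓ₃ ⊆ B then (1 : ℚ) else 0)) * (f b 2 - 2 * f b 1 + f b 0) +
        (if ℓ₁ ∪ ℓ₂ ∪ ℓ₃ ⊆ B then (1 : ℚ) else 0) * (f b 3 - 3 * f b 2 + 3 * f b 1 - f b 0) := by
    intro B hB
    rw [Finset.mem_powersetCard] at hB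
    rw [lam3_eq_of_triangle h1 h2 h3 r1 r2 r3 n12 n13 n23 hfree hB.1, hB.2]
    simp only [Finset.union_subset_iff]
    by_cases a1 : ℓ₁ ⊆ B <;> by_cases a2 : ℓ₂ ⊆ B <;> by_cases a3 : ℓ₃ ⊆ B <;> simp [a1, a2, a3] <;> ring
  rw [Finset.sum_congr rfl hpt]
  simp only [Finset.sum_add_distrib, Finset.sum_const, Finset.card_powersetCard, nsmul_eq_mul, ← Finset.sum_mul,
    Finset.sum_boole]
  have c1 := card_filter_subset_powersetCard' s1 b
  have c2 := card_filter_subset_powersetCard' s2 b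
  have c3 := card_filter_subset_powersetCard' s3 b
  have c12 := card_filter_subset_powersetCard' (Finset.union_subset s1 s2) b
  have c13 := card_filter_subset_powersetCard' (Finset.union_subset s1 s3) b
  have c23 := card_filter_subset_powersetCard' (Finset.union_subset s2 s3) b
  have c123 := card_filter_subset_powersetCard' (u123 ▸ Finset.Subset.refl G : ℓ₁ ∪ ℓ₂ ∪ ℓ₃ ⊆ G) b
  have d1 : (G \ ℓ₁).card = 3 := by rw [Finset.card_sdiff, Finset.inter_eq_left.2 s1, hg, h1]
  have d2 : (G \ ℓ₂).card = 3 := by rw [Finset.card_sdiff, Finset.inter_eq_left.2 s2, hg, h2]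
  have d3 : (G \ ℓ₃).card = 3 := by rw [Finset.card_sdiff, Finset.inter_eq_left.2 s3, hg, h3]
  have d12 : (G \ (ℓ₁ ∪ ℓ₂)).card = 1 := by
    rw [Finset.card_sdiff, Finset.inter_eq_left.2 (Finset.union_subset s1 s2), hg, u12]
  have d13 : (G \ (ℓ₁ ∪ ℓ₃)).card = 1 := by
    rw [Finset.card_sdiff, Finset.inter_eq_left.2 (Finset.union_subset s1 s3), hg, u13]
  have d23 : (G \ (ℓ₂ ∪ ℓ₃)).card = 1 := by
    rw [Finset.card_sdiff, Finset.inter_eq_left.2 (Finset.union_subset s2 s3), hg, u23]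
  have d123 : (G \ (ℓ₁ ∪ ℓ₂ ∪ ℓ₃)).card = 0 := by rw [u123, Finset.sdiff_self, Finset.card_empty]
  have e123 : (ℓ₁ ∪ ℓ₂ ∪ ℓ₃).card = 6 := by rw [u123, hg]
  rw [c1, c2, c3, c12, c13, c23, c123, d1, d2, d3, d12, d13, d23, d123, h1, h2, h3, u12, u13, u23, e123, hg]
  push_cast
  ring

/-- The demand count of the triangle at type `t`. -/
theorem card_filter_R3_triangle {G ℓ₁ ℓ₂ ℓ₃ : Finset α} (hG : G ∈ planes M) (s1 : ℓ₁ ⊆ G) (s2 : ℓ₂ ⊆ G)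
    (s3 : ℓ₃ ⊆ G) (h1 : ℓ₁.card = 3) (h2 : ℓ₂.card = 3) (h3 : ℓ₃.card = 3)
    (r1 : M.eRk (ℓ₁ : Set α) = 2) (r2 : M.eRk (ℓ₂ : Set α) = 2) (r3 : M.eRk (ℓ₃ : Set α) = 2)
    (n12 : ℓ₁ ≠ ℓ₂) (n13 : ℓ₁ ≠ ℓ₃) (n23 : ℓ₂ ≠ ℓ₃)
    (hfree : ∀ T ∈ G.powersetCard 3, T ≠ ℓ₁ → T ≠ ℓ₂ → T ≠ ℓ₃ → M.Indep (T : Set α)) (hg : G.card = 6)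
    (t : ℕ) :
    ((R3 M G).filter (fun B => B.card + t ≤ G.card)).card =
      (if 3 + t ≤ 6 then Nat.choose 6 3 - 3 else 0) + (if 4 + t ≤ 6 then Nat.choose 6 4 else 0) +
        (if 5 + t ≤ 6 then Nat.choose 6 5 else 0) + (if 6 + t ≤ 6 then Nat.choose 6 6 else 0) := by
  have hc : ∀ k : ℕ, ((G.powersetCard k).filter (fun B => B.card + t ≤ G.card)).card =
      if k + t ≤ 6 then Nat.choose 6 k else 0 := by
    intro k
    by_cases hk : k + t ≤ 6
    · rw [if_pos hk, ← hg, ← Finset.card_powersetCard]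
      congr 1
      apply Finset.filter_true_of_mem
      intro B hB
      rw [(Finset.mem_powersetCard.1 hB).2, hg]
      exact hk
    · rw [if_neg hk, Finset.card_eq_zero, Finset.filter_eq_empty_iff]
      intro B hB
      rw [(Finset.mem_powersetCard.1 hB).2, hg]
      exact hk
  have htri : ({ℓ₁, ℓ₂, ℓ₃} : Finset (Finset α)) ⊆ G.powersetCard 3 := by
    intro T hT
    rw [Finset.mem_insert, Finset.mem_insert, Finset.mem_singleton] at hT
    rcases hT with rfl | rfl | rfl
    · exact Finset.mem_powersetCard.2 ⟨s1, h1⟩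
    · exact Finset.mem_powersetCard.2 ⟨s2, h2⟩
    · exact Finset.mem_powersetCard.2 ⟨s3, h3⟩
  have hcard3 : ({ℓ₁, ℓ₂, ℓ₃} : Finset (Finset α)).card = 3 := by
    rw [Finset.card_insert_of_notMem, Finset.card_pair n23]
    rw [Finset.mem_insert, Finset.mem_singleton]
    push Not
    exact ⟨n12, n13⟩
  have hc3 : (((G.powersetCard 3) \ {ℓ₁, ℓ₂, ℓ₃}).filter (fun B => B.card + t ≤ G.card)).card =
      if 3 + t ≤ 6 then Nat.choose 6 3 - 3 else 0 := by
    by_cases hk : 3 + t ≤ 6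
    · rw [if_pos hk, Finset.filter_true_of_mem (fun B hB => by
        rw [(Finset.mem_powersetCard.1 (Finset.mem_sdiff.1 hB).1).2, hg]; exact hk),
        Finset.card_sdiff_of_subset htri, hcard3, Finset.card_powersetCard, hg]
    · rw [if_neg hk, Finset.card_eq_zero, Finset.filter_eq_empty_iff]
      intro B hB
      rw [(Finset.mem_powersetCard.1 (Finset.mem_sdiff.1 hB).1).2, hg]
      exact hk
  have hdj : ∀ i j : ℕ, i ≠ j → Disjoint ((G.powersetCard i).filter (fun B => B.card + t ≤ G.card))
      ((G.powersetCard j).filter (fun B => B.card + t ≤ G.card)) :=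
    fun i j h => Finset.disjoint_filter_filter (disjoint_powersetCard_of_ne G h)
  have hdj3 : ∀ j : ℕ, 3 ≠ j → Disjoint (((G.powersetCard 3) \ {ℓ₁, ℓ₂, ℓ₃}).filter (fun B => B.card + t ≤ G.card))
      ((G.powersetCard j).filter (fun B => B.card + t ≤ G.card)) :=
    fun j h => Finset.disjoint_filter_filter (Finset.disjoint_of_subset_left Finset.sdiff_subset
      (disjoint_powersetCard_of_ne G h))
  rw [R3_eq_of_triangle hG r1 r2 r3 hfree hg, Finset.filter_union, Finset.filter_union, Finset.filter_union,
    Finset.card_union_of_disjoint, Finset.card_union_of_disjoint, Finset.card_union_of_disjoint (hdj3 4 (by decide)),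
    hc3, hc 4, hc 5, hc 6]
  · rw [Finset.disjoint_union_left]
    exact ⟨hdj3 5 (by decide), hdj 4 5 (by decide)⟩
  · rw [Finset.disjoint_union_left, Finset.disjoint_union_left]
    exact ⟨⟨hdj3 6 (by decide), hdj 4 6 (by decide)⟩, hdj 5 6 (by decide)⟩

/-- The cell sum of the triangle. -/
theorem sum_R3_triangle {G ℓ₁ ℓ₂ ℓ₃ : Finset α} (hG : G ∈ planes M) (s1 : ℓ₁ ⊆ G) (s2 : ℓ₂ ⊆ G) (s3 : ℓ₃ ⊆ G)
    (h1 : ℓ₁.card = 3) (h2 : ℓ₂.card = 3) (h3 : ℓ₃.card = 3)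
    (r1 : M.eRk (ℓ₁ : Set α) = 2) (r2 : M.eRk (ℓ₂ : Set α) = 2) (r3 : M.eRk (ℓ₃ : Set α) = 2)
    (n12 : ℓ₁ ≠ ℓ₂) (n13 : ℓ₁ ≠ ℓ₃) (n23 : ℓ₂ ≠ ℓ₃)
    (u12 : (ℓ₁ ∪ ℓ₂).card = 5) (u13 : (ℓ₁ ∪ ℓ₃).card = 5) (u23 : (ℓ₂ ∪ ℓ₃).card = 5)
    (u123 : ℓ₁ ∪ ℓ₂ ∪ ℓ₃ = G) (hg : G.card = 6)
    (hfree : ∀ T ∈ G.powersetCard 3, T ≠ ℓ₁ → T ≠ ℓ₂ → T ≠ ℓ₃ → M.Indep (T : Set α)) (f : ℕ → ℕ → ℚ) :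
    ∑ B ∈ R3 M G, f B.card (lam3 M B) =
      17 * f 3 0 + (15 * f 4 0 + 9 * (f 4 1 - f 4 0)) +
      (6 * f 5 0 + 9 * (f 5 1 - f 5 0) + 3 * (f 5 2 - 2 * f 5 1 + f 5 0)) +
      (f 6 0 + 3 * (f 6 1 - f 6 0) + 3 * (f 6 2 - 2 * f 6 1 + f 6 0) + (f 6 3 - 3 * f 6 2 + 3 * f 6 1 - f 6 0)) := by
  have hdj : ∀ i j : ℕ, i ≠ j → Disjoint (G.powersetCard i) (G.powersetCard j) :=
    fun i j h => disjoint_powersetCard_of_ne G h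
  have hdj3 : ∀ j : ℕ, 3 ≠ j → Disjoint ((G.powersetCard 3) \ {ℓ₁, ℓ₂, ℓ₃}) (G.powersetCard j) :=
    fun j h => Finset.disjoint_of_subset_left Finset.sdiff_subset (disjoint_powersetCard_of_ne G h)
  rw [R3_eq_of_triangle hG r1 r2 r3 hfree hg, Finset.sum_union, Finset.sum_union,
    Finset.sum_union (hdj3 4 (by decide))]
  · have htri : ({ℓ₁, ℓ₂, ℓ₃} : Finset (Finset α)) ⊆ G.powersetCard 3 := by
      intro T hT
      rw [Finset.mem_insert, Finset.mem_insert, Finset.mem_singleton] at hT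
      rcases hT with rfl | rfl | rfl
      · exact Finset.mem_powersetCard.2 ⟨s1, h1⟩
      · exact Finset.mem_powersetCard.2 ⟨s2, h2⟩
      · exact Finset.mem_powersetCard.2 ⟨s3, h3⟩
    have hcard3 : ({ℓ₁, ℓ₂, ℓ₃} : Finset (Finset α)).card = 3 := by
      rw [Finset.card_insert_of_notMem, Finset.card_pair n23]
      rw [Finset.mem_insert, Finset.mem_singleton]
      push Not
      exact ⟨n12, n13⟩
    have hsum3 : ∑ B ∈ (G.powersetCard 3) \ {ℓ₁, ℓ₂, ℓ₃}, f B.card (lam3 M B) = 17 * f 3 0 := by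
      have : ∀ B ∈ (G.powersetCard 3) \ {ℓ₁, ℓ₂, ℓ₃}, f B.card (lam3 M B) = f 3 0 := by
        intro B hB
        rw [Finset.mem_sdiff, Finset.mem_insert, Finset.mem_insert, Finset.mem_singleton] at hB
        push Not at hB
        have hB' := Finset.mem_powersetCard.1 hB.1
        rw [lam3_eq_of_triangle h1 h2 h3 r1 r2 r3 n12 n13 n23 hfree hB'.1, hB'.2, if_neg, if_neg, if_neg]
        · intro h; exact hB.2.2.2 (Finset.eq_of_subset_of_card_le h (by rw [hB'.2, h3])).symm
        · intro h; exact hB.2.2.1 (Finset.eq_of_subset_of_card_le h (by rw [hB'.2, h2])).symm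
        · intro h; exact hB.2.1 (Finset.eq_of_subset_of_card_le h (by rw [hB'.2, h1])).symm
      rw [Finset.sum_congr rfl this, Finset.sum_const, Finset.card_sdiff_of_subset htri, hcard3,
        Finset.card_powersetCard, hg, nsmul_eq_mul]
      norm_num [Nat.choose]
    rw [hsum3, sum_powersetCard_triangle s1 s2 s3 h1 h2 h3 r1 r2 r3 n12 n13 n23 u12 u13 u23 u123 hg hfree f 4,
      sum_powersetCard_triangle s1 s2 s3 h1 h2 h3 r1 r2 r3 n12 n13 n23 u12 u13 u23 u123 hg hfree f 5,
      sum_powersetCard_triangle s1 s2 s3 h1 h2 h3 r1 r2 r3 n12 n13 n23 u12 u13 u23 u123 hg hfree f 6]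
    norm_num [Nat.choose]
  · rw [Finset.disjoint_union_left]
    exact ⟨hdj3 5 (by decide), hdj 4 5 (by decide)⟩
  · rw [Finset.disjoint_union_left, Finset.disjoint_union_left]
    exact ⟨⟨hdj3 6 (by decide), hdj 4 6 (by decide)⟩, hdj 5 6 (by decide)⟩

/-- **The triangle at `t = 1, 2, 3`.** -/
theorem perPlane_triangle (hs : Simple M) (hrank : M.eRank = 7) {G ℓ₁ ℓ₂ ℓ₃ : Finset α} (hG : G ∈ planes M)
    (s1 : ℓ₁ ⊆ G) (s2 : ℓ₂ ⊆ G) (s3 : ℓ₃ ⊆ G) (h1 : ℓ₁.card = 3) (h2 : ℓ₂.card = 3) (h3 : ℓ₃.card = 3)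
    (r1 : M.eRk (ℓ₁ : Set α) = 2) (r2 : M.eRk (ℓ₂ : Set α) = 2) (r3 : M.eRk (ℓ₃ : Set α) = 2)
    (n12 : ℓ₁ ≠ ℓ₂) (n13 : ℓ₁ ≠ ℓ₃) (n23 : ℓ₂ ≠ ℓ₃)
    (u12 : (ℓ₁ ∪ ℓ₂).card = 5) (u13 : (ℓ₁ ∪ ℓ₃).card = 5) (u23 : (ℓ₂ ∪ ℓ₃).card = 5)
    (u123 : ℓ₁ ∪ ℓ₂ ∪ ℓ₃ = G) (hg : G.card = 6)
    (hfree : ∀ T ∈ G.powersetCard 3, T ≠ ℓ₁ → T ≠ ℓ₂ → T ≠ ℓ₃ → M.Indep (T : Set α))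
    {t : ℕ} (ht1 : 1 ≤ t) (ht3 : t ≤ 3)
    (ht : M.eRk ((gr M \ G : Finset α) : Set α) + (t : ℕ∞) = 7)
    (hno4 : ∀ L ∈ lines M, (L ∩ G).card ≤ 3)
    (hdem : (UqG M 7 3 G).card ≤ ((R3 M G).filter (fun B => B.card + t ≤ G.card)).card) :
    (28 / 5 : ℚ) * ((UqG M 7 3 G).card : ℚ) ≤ ∑ S ∈ Yq M 7 3, fRule M G S / D M S := by
  have hcard := card_filter_R3_triangle hG s1 s2 s3 h1 h2 h3 r1 r2 r3 n12 n13 n23 hfree hg t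
  rcases (show t = 1 ∨ t = 2 ∨ t = 3 by omega) with rfl | rfl | rfl
  · apply perPlane_t1_of_cell hs hrank hG ht hno4 hdem
    rw [sum_R3_triangle hG s1 s2 s3 h1 h2 h3 r1 r2 r3 n12 n13 n23 u12 u13 u23 u123 hg hfree Cells.vOne, hcard]
    norm_num [Nat.choose]
    linarith [Cells.cell_triangle_t1]
  · apply perPlane_t2_of_cell hs hrank hG ht hno4 hdem
    rw [sum_R3_triangle hG s1 s2 s3 h1 h2 h3 r1 r2 r3 n12 n13 n23 u12 u13 u23 u123 hg hfree Cells.vTwo, hcard]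
    norm_num [Nat.choose]
    linarith [Cells.cell_triangle_t2]
  · apply perPlane_t3_of_cell hs hrank hG ht hno4 hdem
    rw [sum_R3_triangle hG s1 s2 s3 h1 h2 h3 r1 r2 r3 n12 n13 n23 u12 u13 u23 u123 hg hfree Cells.vThree, hcard]
    norm_num [Nat.choose]
    linarith [Cells.cell_triangle_t3]

end SevenThree

end PercRepro
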